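import Summits.BirchSwinnertonDyer.BirchSwinnertonDyer.Theorems.AlignedTransportAtTwoMainConjectureOfRankZeroBSDAtTwoHalfDescentBaseIndexSelmer
import Summits.BirchSwinnertonDyer.BirchSwinnertonDyer.Theorems.AlignedTransportAtTwoMainConjectureOfRankZeroBSDAtTwoHalfDescentLayerIndexGrowthEventual
import Summits.BirchSwinnertonDyer.BirchSwinnertonDyer.Theorems.AlignedTransportAtTwoMainConjectureOfRankZeroBSDAtTwoHalfDescentLayerIndexGrowthFiniteCell
import HarnessLib

/-!
# Route `AlignedTransportAtTwo`, crux C2 `MainConjectureOfRankZeroBSDAtTwo` (stmt-BirchSwinnertonDyer-22298):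
# THE BASE TERM CARRIES `p^μ`, VII — THE HONEST GROWTH LAW AND THE `λ`-READING ON THE CURVE ITSELF: for EVERY dual datum with `X` f.g. torsion in a rank-`0` tower (finite
# submodules ALLOWED) there is `n₁` with, for all `n ≥ n₁`, `#Sel_{p^∞}(E/K_{n+1})·#ker g_{n+1}·#ker h_n = p^{pⁿ(p−1)μ + λ}·#Sel_{p^∞}(E/K_n)·#ker g_n·#ker h_{n+1}` and Iwasawa's formula
# for `#Sel_{p^∞}(E/K_n)·#ker g_n` EXACT; on the cell `E(K)[p] = 0`: `#Sel_{n+1}·#ker g_{n+1} = p^{pⁿ(p−1)μ+λ}·#Sel_n·#ker g_n` — with `μ = 0` the `λ`-invariant IS the eventual growth of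
# the honest Selmer order times the control kernel; `p = 2` seed: `#Sel_{2^∞}(W/ℚ_{n+1})·#ker g_{n+1} = 2^{2ⁿμ+λ}·#Sel_{2^∞}(W/ℚ_n)·#ker g_n`

HONEST FRAMING (cell `bsd-f1-sign2`, WIDTH-5 attached prover seat `bsd-line-att-p5` gen 60 on line `birth` of the lead `bsd-line-att-p2`;
`--supports` stmt-BirchSwinnertonDyer-22298, closes nothing; BSD is NOT proved by any of this; the crux C2, its verdict «blocked-on
`Rank1Residual.GreenbergMuConjectureIrreducible`» and every registered stub (P / T / Kμ / LimDoor / MuIneqʳ / PFμ⁺) are untouched). THEOREMS ONLY — no `def`,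
no instance, no named fact, no `sorry`. Route-independent. Gen 58/59's successor (i) «the λ-reading», here on the CURVE ITSELF in honest currency: gen 54's `…LayerIndexControl`
proved the finite-level law under «`X` has no non-zero finite submodule» (`hnf`); gen 56's `…LayerIndexGrowthEventual.exists_forall_natCard_selmerInvariants_succ_eq_pow_mul` removed `hnf`
for the LIMIT invariants `#Sel_∞^{Γ_n}`; this file pushes that through Greenberg's Lemma 4.3 (tree, unconditional `Nat.card` identity `#Sel_∞^{Γ_n}·#ker h_n = #Sel_n·#ker g_n`) to the
honest Selmer groups `Sel_{p^∞}(E/K_n)`, with NO finite-submodule hypothesis, and reads the `λ`-invariant off honest data on gen 57's cell (`E(K)[p] = 0`: `#ker h_n = 1`, tree/g57).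

THE POINT (`E/K`, `κ` ANY `ℤ_p`-extension with topological generator `γ`, `D` any Pontryagin-dual datum with `X` f.g. torsion, `char X = (f)`, RANK-`0` TOWER `f(0) ≠ 0`, `Ψ_m ∤ f`):
* §1 ★★★ `exists_forall_natCard_selmerLayer_succ_mul_eq`: **`∃ n₁, ∀ n ≥ n₁: #Sel_{n+1}·#ker g_{n+1}·#ker h_n = p^{pⁿ(p−1)·μ + λ}·#Sel_n·#ker g_n·#ker h_{n+1}`** and
  **`#Sel_n·#ker g_n·#ker h_{n₁}·p^{μp^{n₁}+λn₁} = #Sel_{n₁}·#ker g_{n₁}·#ker h_n·p^{μpⁿ+λn}`** (Iwasawa's `e_n = μpⁿ + λn + ν` for `#Sel_{p^∞}(E/K_n)·#ker g_n/#ker h_n`, EXACT from `n₁`,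
  finite submodule allowed — the `ν` is whatever it is at `n₁`).
* §2 (cell `E(K)[p] = 0`) ★★★ `exists_forall_natCard_selmerLayer_succ_mul_kerG_eq`: **`#Sel_{n+1}·#ker g_{n+1} = p^{pⁿ(p−1)·μ + λ}·#Sel_n·#ker g_n` for `n ≥ n₁`**;
  ★★★ `exists_forall_natCard_selmerLayer_succ_mul_kerG_eq_pow_lambda_mul` (THE `λ`-READING): **`μ = 0 ⟹ #Sel_{n+1}·#ker g_{n+1} = p^{λ}·#Sel_n·#ker g_n` for `n ≥ n₁`** — the `λ`-invariant of
  `X(E/K_∞)` is the eventual one-step growth exponent of the honest number `#Sel_{p^∞}(E/K_n)·#ker g_n`.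
* §3 (`p = 2`, `W/ℚ` without rational `2`-torsion abscissa — the seed cell's torsion condition) ★★★ `exists_forall_natCard_selmerLayer_succ_mul_kerG_eq_two`:
  **`#Sel_{2^∞}(W/ℚ_{n+1})·#ker g_{n+1} = 2^{2ⁿμ₂ + λ₂}·#Sel_{2^∞}(W/ℚ_n)·#ker g_n`** for `n ≥ n₁`; with `μ₂ = 0`: **`= 2^{λ₂}·#Sel_{2^∞}(W/ℚ_n)·#ker g_n`**.
Reading for C2: together with file III's `2^{2ⁿμ₂} ∣ #Sel_n·#ker g_n` and file IV's completeness, the honest sequence `a_n = #Sel_{2^∞}(W/ℚ_n)·#ker g_n(W/ℚ_n)` of a rank-`0` seed determines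
BOTH invariants: `μ₂ = 0 ⟺ ∃ n, a_n < 2^{2ⁿ}`, and then `a_{n+1} = 2^{λ₂}·a_n` eventually. Nothing numerical is asserted; C2 untouched. Memo `Cruxes/MainConjectureOfRankZeroBSDAtTwo/BASE-TERM-att-p5-g60.md`.

References: R. Greenberg, LNM 1716 (1999), Thm. 1.10, §3 Lemmas 3.1–3.2, §4 Lemma 4.3 (p. 103), Prop. 4.14–4.15 [GreenbergLNM1716]; K. Iwasawa, Bull. AMS 65 (1959); L. Washington,
GTM 83, §13.3 Thm. 13.13 [Washington1997]; B. Mazur, Invent. Math. 18 (1972) §6 [Mazur1972].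
-/

set_option linter.dupNamespace false
set_option autoImplicit false

noncomputable section

open scoped Classical Polynomial

universe u

namespace Summit.BirchSwinnertonDyer.BirchSwinnertonDyer.Theorems.AlignedTransportAtTwoHalfDescentBaseIndexGrowthLaw

open WeierstrassCurve Literature.NumberTheory.EllipticCurves Literature.NumberTheory.EllipticCurves.IwasawaAlgebra Literature.NumberTheory.EllipticCurves.Greenberg1999
  Summit.BirchSwinnertonDyer.Rank1Residual.X1.MuLambda
  Summit.BirchSwinnertonDyer.Rank1Residual.Iwasawa
  Summit.BirchSwinnertonDyer.BirchSwinnertonDyer.Theorems.AlignedTransportAtTwoHalfDescentLayerIndexGrowthEventual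
  Summit.BirchSwinnertonDyer.BirchSwinnertonDyer.Theorems.AlignedTransportAtTwoHalfDescentLayerIndexGrowthFiniteCell

/-! ## §1 The honest growth law, finite submodules allowed -/

section AnyField

variable {K : Type u} [Field K] [NumberField K] (W : WeierstrassCurve K) {p : ℕ} [hp : Fact p.Prime] (κ : ZpExtension K p)
  {γ : Field.absoluteGaloisGroup K}

/-- ★★★ **THE HONEST GROWTH LAW WITHOUT «NO FINITE SUBMODULE».** `E/K`, `κ` ANY `ℤ_p`-extension with topological generator `γ`, `D` any Pontryagin-dual datum with `X` f.g. torsion,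
`char_Λ X = (f)`, rank-`0` tower (`f(0) ≠ 0`, `Ψ_m ∤ f` for all `m`). Then there is `n₁` such that for every `n ≥ n₁`:
**`#Sel_{p^∞}(E/K_{n+1})·#ker g_{n+1}·#ker h_n = p^{pⁿ(p−1)·μ + λ}·#Sel_{p^∞}(E/K_n)·#ker g_n·#ker h_{n+1}`** and
**`#Sel_{p^∞}(E/K_n)·#ker g_n·#ker h_{n₁}·p^{μp^{n₁}+λn₁} = #Sel_{p^∞}(E/K_{n₁})·#ker g_{n₁}·#ker h_n·p^{μpⁿ+λn}`** (`μ = μ(X)`, `λ = λ(X)`; `h_m : H¹(K_m, E[p^∞]) → H¹(K_∞, E[p^∞])`,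
`ker g_m = A_m/Sel_m`). [cite: GreenbergLNM1716, Thm. 1.10 and §4 Lemma 4.3 (p. 103)] [cite: Washington1997, §13.3 Thm. 13.13] -/
theorem exists_forall_natCard_selmerLayer_succ_mul_eq (hγ : κ.IsTopGenerator γ) (D : W.SelmerDualData κ γ) [Module.Finite (IwasawaAlgebra p) D.X] (hD : D.IsTorsion)
    {f : IwasawaAlgebra p} (hchar : D.charIdeal = Ideal.span {f}) (h0 : PowerSeries.constantCoeff f ≠ 0)
    (hΨ : ∀ m, ¬ ((((Polynomial.cyclotomic (p ^ (m + 1)) ℤ_[p]).comp (Polynomial.X + 1) : ℤ_[p][X]) : IwasawaAlgebra p) ∣ f)) :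
    ∃ n₁ : ℕ, ∀ n, n₁ ≤ n →
      Nat.card ↥(W.selmerLayer κ (n + 1)) * Nat.card (W.KerG κ (n + 1)) * Nat.card (W.layerToInfty κ n).ker =
        p ^ (p ^ n * (p - 1) * D.mu + D.lambda) * (Nat.card ↥(W.selmerLayer κ n) * Nat.card (W.KerG κ n)) * Nat.card (W.layerToInfty κ (n + 1)).ker ∧
      Nat.card ↥(W.selmerLayer κ n) * Nat.card (W.KerG κ n) * Nat.card (W.layerToInfty κ n₁).ker * p ^ (D.mu * p ^ n₁ + D.lambda * n₁) =
        Nat.card ↥(W.selmerLayer κ n₁) * Nat.card (W.KerG κ n₁) * Nat.card (W.layerToInfty κ n).ker * p ^ (D.mu * p ^ n + D.lambda * n) := by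
  obtain ⟨n₁, h⟩ := exists_forall_natCard_selmerInvariants_succ_eq_pow_mul W κ hγ D hD hchar h0 hΨ
  refine ⟨n₁, fun n hn ↦ ?_⟩
  obtain ⟨hstep, hiw⟩ := h n hn
  have h43 := W.natCard_selmerInvariants_mul_natCard_ker_layerToInfty κ n
  have h43' := W.natCard_selmerInvariants_mul_natCard_ker_layerToInfty κ (n + 1)
  have h43₁ := W.natCard_selmerInvariants_mul_natCard_ker_layerToInfty κ n₁
  constructor
  · calc Nat.card ↥(W.selmerLayer κ (n + 1)) * Nat.card (W.KerG κ (n + 1)) * Nat.card (W.layerToInfty κ n).ker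
        = (Nat.card ↥(W.selmerInfty κ ⊓ W.layerInvariants κ (n + 1)) * Nat.card (W.layerToInfty κ (n + 1)).ker) * Nat.card (W.layerToInfty κ n).ker := by rw [h43']
      _ = p ^ (p ^ n * (p - 1) * D.mu + D.lambda) * (Nat.card ↥(W.selmerInfty κ ⊓ W.layerInvariants κ n) * Nat.card (W.layerToInfty κ n).ker) *
            Nat.card (W.layerToInfty κ (n + 1)).ker := by rw [hstep]; ring
      _ = _ := by rw [h43]
  · calc Nat.card ↥(W.selmerLayer κ n) * Nat.card (W.KerG κ n) * Nat.card (W.layerToInfty κ n₁).ker * p ^ (D.mu * p ^ n₁ + D.lambda * n₁)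
        = (Nat.card ↥(W.selmerInfty κ ⊓ W.layerInvariants κ n) * p ^ (D.mu * p ^ n₁ + D.lambda * n₁)) * Nat.card (W.layerToInfty κ n).ker *
            Nat.card (W.layerToInfty κ n₁).ker := by rw [← h43]; ring
      _ = (Nat.card ↥(W.selmerInfty κ ⊓ W.layerInvariants κ n₁) * Nat.card (W.layerToInfty κ n₁).ker) * Nat.card (W.layerToInfty κ n).ker *
            p ^ (D.mu * p ^ n + D.lambda * n) := by rw [hiw]; ring
      _ = _ := by rw [h43₁]

/-! ## §2 The cell `E(K)[p] = 0`: the restriction kernels are trivial, the `λ`-reading -/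

variable [W.IsElliptic]

/-- ★★★ **ON THE CELL `E(K)[p] = 0`: `#Sel_{p^∞}(E/K_{n+1})·#ker g_{n+1} = p^{pⁿ(p−1)·μ + λ}·#Sel_{p^∞}(E/K_n)·#ker g_n` for all `n ≥ n₁`**, and Iwasawa's formula
**`#Sel_n·#ker g_n·p^{μp^{n₁}+λn₁} = #Sel_{n₁}·#ker g_{n₁}·p^{μpⁿ+λn}`** — `X` f.g. torsion in a rank-`0` tower, finite submodule allowed (`#ker h_m = 1` for all `m`: g57/tree).
[cite: GreenbergLNM1716, Thm. 1.10, §3 Lemma 3.1, §4 Lemma 4.3] [cite: Washington1997, §13.3 Thm. 13.13] -/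
theorem exists_forall_natCard_selmerLayer_succ_mul_kerG_eq (hK : ∀ P : W.toAffine.Point, p • P = 0 → P = 0) (hγ : κ.IsTopGenerator γ) (D : W.SelmerDualData κ γ)
    [Module.Finite (IwasawaAlgebra p) D.X] (hD : D.IsTorsion) {f : IwasawaAlgebra p} (hchar : D.charIdeal = Ideal.span {f}) (h0 : PowerSeries.constantCoeff f ≠ 0)
    (hΨ : ∀ m, ¬ ((((Polynomial.cyclotomic (p ^ (m + 1)) ℤ_[p]).comp (Polynomial.X + 1) : ℤ_[p][X]) : IwasawaAlgebra p) ∣ f)) :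
    ∃ n₁ : ℕ, ∀ n, n₁ ≤ n →
      Nat.card ↥(W.selmerLayer κ (n + 1)) * Nat.card (W.KerG κ (n + 1)) = p ^ (p ^ n * (p - 1) * D.mu + D.lambda) * (Nat.card ↥(W.selmerLayer κ n) * Nat.card (W.KerG κ n)) ∧
      Nat.card ↥(W.selmerLayer κ n) * Nat.card (W.KerG κ n) * p ^ (D.mu * p ^ n₁ + D.lambda * n₁) =
        Nat.card ↥(W.selmerLayer κ n₁) * Nat.card (W.KerG κ n₁) * p ^ (D.mu * p ^ n + D.lambda * n) := by
  obtain ⟨n₁, h⟩ := exists_forall_natCard_selmerLayer_succ_mul_eq W κ hγ D hD hchar h0 hΨ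
  refine ⟨n₁, fun n hn ↦ ?_⟩
  obtain ⟨hstep, hiw⟩ := h n hn
  rw [natCard_ker_layerToInfty_eq_one W κ hK n, natCard_ker_layerToInfty_eq_one W κ hK (n + 1), mul_one, mul_one] at hstep
  rw [natCard_ker_layerToInfty_eq_one W κ hK n, natCard_ker_layerToInfty_eq_one W κ hK n₁, mul_one, mul_one] at hiw
  exact ⟨hstep, hiw⟩

/-- ★★★ **THE `λ`-READING ON THE CURVE ITSELF.** On the cell `E(K)[p] = 0`, for a dual datum with `X` f.g. torsion in a rank-`0` tower and **`μ(X(E/K_∞)) = 0`**: there is `n₁` with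
**`#Sel_{p^∞}(E/K_{n+1})·#ker g_{n+1} = p^{λ}·#Sel_{p^∞}(E/K_n)·#ker g_n` for all `n ≥ n₁`** and **`#Sel_{p^∞}(E/K_n)·#ker g_n·p^{λn₁} = #Sel_{p^∞}(E/K_{n₁})·#ker g_{n₁}·p^{λn}`** — the
`λ`-invariant is the eventual one-step growth exponent of the honest number `#Sel_{p^∞}(E/K_n)·#ker g_n`. [cite: GreenbergLNM1716, Thm. 1.10, §4 Lemma 4.3] [cite: Washington1997, §13.3 Thm. 13.13] -/
theorem exists_forall_natCard_selmerLayer_succ_mul_kerG_eq_pow_lambda_mul (hK : ∀ P : W.toAffine.Point, p • P = 0 → P = 0) (hγ : κ.IsTopGenerator γ)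
    (D : W.SelmerDualData κ γ) [Module.Finite (IwasawaAlgebra p) D.X] (hD : D.IsTorsion) {f : IwasawaAlgebra p} (hchar : D.charIdeal = Ideal.span {f})
    (h0 : PowerSeries.constantCoeff f ≠ 0) (hΨ : ∀ m, ¬ ((((Polynomial.cyclotomic (p ^ (m + 1)) ℤ_[p]).comp (Polynomial.X + 1) : ℤ_[p][X]) : IwasawaAlgebra p) ∣ f))
    (hμ : D.mu = 0) :
    ∃ n₁ : ℕ, ∀ n, n₁ ≤ n →
      Nat.card ↥(W.selmerLayer κ (n + 1)) * Nat.card (W.KerG κ (n + 1)) = p ^ D.lambda * (Nat.card ↥(W.selmerLayer κ n) * Nat.card (W.KerG κ n)) ∧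
      Nat.card ↥(W.selmerLayer κ n) * Nat.card (W.KerG κ n) * p ^ (D.lambda * n₁) = Nat.card ↥(W.selmerLayer κ n₁) * Nat.card (W.KerG κ n₁) * p ^ (D.lambda * n) := by
  obtain ⟨n₁, h⟩ := exists_forall_natCard_selmerLayer_succ_mul_kerG_eq W κ hK hγ D hD hchar h0 hΨ
  refine ⟨n₁, fun n hn ↦ ?_⟩
  obtain ⟨hstep, hiw⟩ := h n hn
  rw [hμ, mul_zero, zero_add] at hstep
  rw [hμ, zero_mul, zero_add, zero_mul, zero_add] at hiw
  exact ⟨hstep, hiw⟩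

end AnyField

/-! ## §3 `p = 2`, `W/ℚ` without rational `2`-torsion abscissa -/

section Two

variable (W : WeierstrassCurve ℚ) [W.IsElliptic] (κ : ZpExtension ℚ 2) {γ : Field.absoluteGaloisGroup ℚ}

/-- ★★★ `p = 2`, **THE HONEST GROWTH LAW AND THE `λ`-READING ON THE SEED CELL'S TORSION CONDITION**: `W/ℚ` elliptic with no rational `2`-torsion abscissa, `κ` any `ℤ₂`-extension with
topological generator `γ`, `D` any dual datum with `X` torsion, `char X = (f)`, rank-`0` tower. Then there is `n₁` with, for all `n ≥ n₁`,
**`#Sel_{2^∞}(W/ℚ_{n+1})·#ker g_{n+1} = 2^{2ⁿ·μ₂ + λ₂}·#Sel_{2^∞}(W/ℚ_n)·#ker g_n`**, and if `μ₂ = 0`: **`#Sel_{2^∞}(W/ℚ_{n+1})·#ker g_{n+1} = 2^{λ₂}·#Sel_{2^∞}(W/ℚ_n)·#ker g_n`**.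
[cite: GreenbergLNM1716, Thm. 1.10, §4 Lemma 4.3] [cite: Washington1997, §13.3 Thm. 13.13] [cite: SilvermanAEC2009, III.§2] -/
theorem exists_forall_natCard_selmerLayer_succ_mul_kerG_eq_two (ht : ∀ x : ℚ, ¬ HasRationalTwoTorsionX W x) (hγ : κ.IsTopGenerator γ) (D : W.SelmerDualData κ γ)
    (hD : D.IsTorsion) {f : IwasawaAlgebra 2} (hchar : D.charIdeal = Ideal.span {f}) (h0 : PowerSeries.constantCoeff f ≠ 0)
    (hΨ : ∀ m, ¬ ((((Polynomial.cyclotomic (2 ^ (m + 1)) ℤ_[2]).comp (Polynomial.X + 1) : ℤ_[2][X]) : IwasawaAlgebra 2) ∣ f)) :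
    ∃ n₁ : ℕ, ∀ n, n₁ ≤ n →
      Nat.card ↥(W.selmerLayer κ (n + 1)) * Nat.card (W.KerG κ (n + 1)) = 2 ^ (2 ^ n * D.mu + D.lambda) * (Nat.card ↥(W.selmerLayer κ n) * Nat.card (W.KerG κ n)) ∧
      (D.mu = 0 → Nat.card ↥(W.selmerLayer κ (n + 1)) * Nat.card (W.KerG κ (n + 1)) = 2 ^ D.lambda * (Nat.card ↥(W.selmerLayer κ n) * Nat.card (W.KerG κ n))) := by
  haveI : Module.Finite (IwasawaAlgebra 2) D.X := D.module_finite_holds hγ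
  obtain ⟨n₁, h⟩ := exists_forall_natCard_selmerLayer_succ_mul_kerG_eq W κ (forall_two_nsmul_eq_zero W ht) hγ D hD hchar h0 hΨ
  refine ⟨n₁, fun n hn ↦ ?_⟩
  obtain ⟨hstep, -⟩ := h n hn
  rw [show (2 : ℕ) - 1 = 1 from rfl, mul_one] at hstep
  exact ⟨hstep, fun hμ ↦ by rw [hstep, hμ, mul_zero, zero_add]⟩

end Two

end Summit.BirchSwinnertonDyer.BirchSwinnertonDyer.Theorems.AlignedTransportAtTwoHalfDescentBaseIndexGrowthLaw

end
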